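import Mathlib.MeasureTheory.Measure.Haar.DistribChar
import Mathlib.MeasureTheory.Measure.WithDensity
import Mathlib.MeasureTheory.Integral.Bochner.Set
import Summits.HodgeConjecture.HodgeConjecture.Theorems.F0P3cStCharTSHeightShellFundamentalDomain   -- ★ B1 «HEIGHT-SHELL FUNDAMENTAL DOMAINS★» (this seat)
import HarnessLib

/-!
# F0 · P3c · line LH6 «StCharTS» — «MODULUS-SHELL CHARACTER VANISHING★» (generic base layer): over a locally compact commutative ring, a function that is invariant under a unit of
# module `> 1` and picks up a factor `c ≠ 1` under another unit integrates to ZERO against `‖b‖⁻¹ db` over every modulus annulus `{A/‖γ‖ < ‖b‖ ≤ A}`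
# [TateThesis1967 §2.4; WeilBNT1967 VII §2; Keys1984 §7]

Cell `pub/hodgecm-mathlib`, crux H413 = `stmt-HodgeConjecture-24833` (lane `--supports … --as helper`), route HCCMUnconditional; seat F0P2-p06 (g21); a GENERIC brick under
LEAD F0P3a-plan (g15) STANDING RULE 20 (T14-67: theorems-only base layer, no road ∕ organ ∕ rider).  THEOREMS ONLY (0 def ∕ 0 instance ∕ 0 notation ∕ 0 sorry); imports Mathlib +
★ B1 + HarnessLib.  No field, no valuation, no uniformiser, no residue field: `R` is any locally compact Hausdorff second-countable commutative topological ring with a Haar measure `μ`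
and Mathlib's module `‖·‖_R = distribHaarChar R : Rˣ →* ℝ≥0`; the «norm» is any measurable `nrm : R → ℝ≥0`, `Rˣ`-equivariant (`nrm (u b) = ‖u‖_R · nrm b`) and positive `μ`-a.e.
(for a local field: `nrm = ‖·‖`, zero exactly at `0`).

WHAT.
* §1 **`measurePreserving_units_smul_withDensity_inv`** — the measure `ν := (nrm b)⁻¹ · μ` («`d×b = db ∕ ‖b‖`») is preserved by EVERY unit homothety `b ↦ u b`
  (Mathlib `distribHaarChar`: `μ ∘ (u·)⁻¹ = ‖u‖⁻¹ μ`, and `nrm (u b)⁻¹ = ‖u‖⁻¹ nrm(b)⁻¹`).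
* §2 **`setIntegral_modulusShell_eq_zero_of_eigen_unit`** — THE VANISHING: `γ ∈ Rˣ` with `‖γ‖_R > 1`, `h : R → E` with `h (γ b) = h b` and `h (b₀ b) = c • h b` for a unit `b₀` and
  a scalar `c ≠ 1`; then for every `A > 0`
    `∫_{b : A/‖γ‖ < nrm b ≤ A} (nrm b)⁻¹ • h b dμ(b) = 0`
  — ★ B1 `setIntegral_heightShell_eq_zero_of_eigen_smul` on `(R, ν)` with the action of `Rˣ`: the annulus is a fundamental domain for `γ^ℤ`, `b₀` commutes with `γ` and preserves `ν`.
  Also the `ν`-form `setIntegral_modulusShell_withDensity_eq_zero_of_eigen_unit` and the fundamental-domain ∕ instance facts `isFundamentalDomain_modulusShell`,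
  `smulInvariantMeasure_zpowers_units`.
WHY (consumer-in-waiting, rule 20): MEMO `F0/P2/F0P2-p06/g21/MEMO-KEYS3-analytic-road.v3` §3 (ii) = brick B2 (ii) of the in-house road to RUNG 0's named input `hKeysRed3` [Keys1984 §7 Thm. (1),
case (3)]: with `R = L ⊗ L⁺_v` at a non-split `v`, `h(b) = χ₁(σ b)⁻¹`, `γ = α σα` (`χ₁(γ) = 1` as `χ₁|_{F×} = 1`), `b₀` any unit with `χ₁(σ b₀) ≠ 1`: the two-`w`-shell character integral
`∫ χ₁(b̄)⁻¹ d×b` VANISHES — the whole «character sum» content of the analytic half, uniformly in the ramification of `E_w∕F_v` and of `χ₁` (no Gauss sums, no dyadic case).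
Reusable wherever a Tate shell integral of a non-trivial character is shown to vanish.  No census row names it yet.
HONEST LABEL: HC_CM is proved only modulo the 7 printed citations (2 remaining named inputs: hLiu418 = `stmt-HodgeConjecture-24832`, h413 = `stmt-HodgeConjecture-24833`) until rung 0
closes; count-neutral generic measure theory.

## References
* [TateThesis1967] J. Tate, *Fourier analysis in number fields and Hecke's zeta-functions*, in Cassels–Fröhlich (1967), §2.2 Lemma 2.2.5 (`d(ab) = ‖a‖ db`), §2.4 (`∫_{𝒪^×} χ d×x = 0`).
* [WeilBNT1967] A. Weil, *Basic Number Theory* (1967), Ch. I §2 (the module), Ch. VII §2 (integration over `k^×` by shells).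
* [Keys1984] D. Keys, *Principal series representations of special unitary groups over local fields*, Compositio Math. 51 (1984), §7 Thm. (1).
-/

set_option autoImplicit false
-- the mandated namespace has the single-problem summit's repeated segment (`HodgeConjecture.HodgeConjecture`)
set_option linter.dupNamespace false

noncomputable section

open MeasureTheory Set
open scoped Pointwise NNReal ENNReal
open Summit.HodgeConjecture.HodgeConjecture.Cruxes.H413.F0P3cStCharTSHeightShellFundamentalDomain

namespace Summit.HodgeConjecture.HodgeConjecture.Cruxes.H413.F0P3cStCharTSModulusShellCharacterVanishing

variable {R : Type*} [CommRing R] [TopologicalSpace R] [IsTopologicalRing R] [LocallyCompactSpace R] [MeasurableSpace R] [BorelSpace R]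
  (μ : Measure R) [μ.IsAddHaarMeasure] [μ.Regular]
  {nrm : R → ℝ≥0} (hnm : Measurable nrm) (hmul : ∀ (u : Rˣ) (b : R), nrm ((u : R) * b) = distribHaarChar R u * nrm b)

/-! ## §1 `d×b = db ∕ ‖b‖` is invariant under every unit homothety -/

/-- **`map (u ·) μ = ‖u‖_R⁻¹ • μ`** for a regular Haar measure `μ` of `R` and a unit `u` (Mathlib `distribHaarChar_mul`; = ★ `HeisRing.map_mul_left_eq_distribHaarChar_inv_smul`,
reproved here to keep the import closure Mathlib + B1). [cite: TateThesis1967, §2.2 Lemma 2.2.5] -/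
theorem map_units_smul_eq (u : Rˣ) : μ.map (fun b : R => u • b) = ((distribHaarChar R u)⁻¹ : ℝ≥0) • μ := by
  have hinv : distribHaarChar R u⁻¹ = (distribHaarChar R u)⁻¹ := eq_inv_of_mul_eq_one_left (by rw [← map_mul, inv_mul_cancel, map_one])
  ext s hs
  rw [Measure.map_apply (measurable_const_smul (u : Rˣ)) hs, Set.preimage_smul, ← distribHaarChar_mul μ u⁻¹ s, hinv, Measure.coe_nnreal_smul_apply]

include hnm hmul in
/-- **The measure `ν = (nrm)⁻¹ · μ` is preserved by every unit homothety `b ↦ u b`**: `‖u‖⁻¹` from the Haar module cancels `‖u‖⁻¹` from the density.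
[cite: TateThesis1967, §2.2 Lemma 2.2.5] [cite: WeilBNT1967, Ch. VII §2] -/
theorem measurePreserving_units_smul_withDensity_inv (u : Rˣ) :
    MeasurePreserving (fun b : R => u • b) (μ.withDensity fun b => ((nrm b)⁻¹ : ℝ≥0)) (μ.withDensity fun b => ((nrm b)⁻¹ : ℝ≥0)) := by
  have hmeas : Measurable (fun b : R => u • b) := measurable_const_smul u
  have hdens : Measurable (fun b : R => (((nrm b)⁻¹ : ℝ≥0) : ℝ≥0∞)) := (hnm.inv).coe_nnreal_ennreal
  have hq : 0 < distribHaarChar R u := distribHaarChar_pos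
  have hu : distribHaarChar R u⁻¹ = (distribHaarChar R u)⁻¹ := eq_inv_of_mul_eq_one_left (by rw [← map_mul, inv_mul_cancel, map_one])
  -- the density transforms by `‖u‖`: `nrm (u⁻¹ b')⁻¹ = ‖u‖ · nrm(b')⁻¹`
  have h3 : ∀ b' : R, (((nrm ((u⁻¹ : Rˣ) • b'))⁻¹ : ℝ≥0) : ℝ≥0∞) = ((distribHaarChar R u : ℝ≥0) : ℝ≥0∞) * (((nrm b')⁻¹ : ℝ≥0) : ℝ≥0∞) := by
    intro b'
    rw [show ((u⁻¹ : Rˣ) • b' : R) = ((u⁻¹ : Rˣ) : R) * b' from rfl, hmul, hu, mul_inv, inv_inv, ENNReal.coe_mul]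
  have hg : Measurable (fun b' : R => (((nrm ((u⁻¹ : Rˣ) • b'))⁻¹ : ℝ≥0) : ℝ≥0∞)) :=
    ((hnm.comp (measurable_const_smul (u⁻¹ : Rˣ))).inv).coe_nnreal_ennreal
  refine ⟨hmeas, ?_⟩
  ext s hs
  rw [Measure.map_apply hmeas hs, withDensity_apply _ (hmeas hs), withDensity_apply _ hs]
  -- change variables along `b ↦ u b`: the density is `g ∘ (u • ·)` with `g b' = nrm (u⁻¹ b')⁻¹`
  have hfun : ((fun b : R => u • b) ⁻¹' s).indicator (fun b : R => (((nrm b)⁻¹ : ℝ≥0) : ℝ≥0∞)) =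
      fun b => s.indicator (fun b' : R => (((nrm ((u⁻¹ : Rˣ) • b'))⁻¹ : ℝ≥0) : ℝ≥0∞)) (u • b) := by
    funext b
    rw [← Set.indicator_comp_right]
    congr 1
    funext b''
    simp only [Function.comp_apply, inv_smul_smul]
  calc ∫⁻ b in (fun b : R => u • b) ⁻¹' s, (((nrm b)⁻¹ : ℝ≥0) : ℝ≥0∞) ∂μ
      = ∫⁻ b, ((fun b : R => u • b) ⁻¹' s).indicator (fun b : R => (((nrm b)⁻¹ : ℝ≥0) : ℝ≥0∞)) b ∂μ := (lintegral_indicator (hmeas hs) _).symm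
    _ = ∫⁻ b, s.indicator (fun b' : R => (((nrm ((u⁻¹ : Rˣ) • b'))⁻¹ : ℝ≥0) : ℝ≥0∞)) (u • b) ∂μ := by rw [hfun]
    _ = ∫⁻ b', s.indicator (fun b' : R => (((nrm ((u⁻¹ : Rˣ) • b'))⁻¹ : ℝ≥0) : ℝ≥0∞)) b' ∂(μ.map (fun b : R => u • b)) :=
        (lintegral_map (hg.indicator hs) hmeas).symm
    _ = ((distribHaarChar R u)⁻¹ : ℝ≥0) • ∫⁻ b' in s, (((nrm ((u⁻¹ : Rˣ) • b'))⁻¹ : ℝ≥0) : ℝ≥0∞) ∂μ := by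
        rw [map_units_smul_eq μ u, lintegral_smul_measure, lintegral_indicator hs]
    _ = ((distribHaarChar R u)⁻¹ : ℝ≥0) • ∫⁻ b' in s, ((distribHaarChar R u : ℝ≥0) : ℝ≥0∞) * (((nrm b')⁻¹ : ℝ≥0) : ℝ≥0∞) ∂μ := by
        simp_rw [h3]
    _ = ∫⁻ b' in s, (((nrm b')⁻¹ : ℝ≥0) : ℝ≥0∞) ∂μ := by
        rw [lintegral_const_mul _ hdens, ENNReal.smul_def, smul_eq_mul, ← mul_assoc, ← ENNReal.coe_mul, inv_mul_cancel₀ hq.ne',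
          ENNReal.coe_one, one_mul]

/-! ## §2 The vanishing over modulus annuli -/

omit [MeasurableSpace R] [BorelSpace R] in
include hmul in
/-- The real height `b ↦ (nrm b : ℝ)` is scaled by `‖γ‖_R` under `b ↦ γ b`. [cite: WeilBNT1967, Ch. I §2] -/
theorem coe_nrm_units_smul (γ : Rˣ) (b : R) : ((nrm (γ • b) : ℝ≥0) : ℝ) = (distribHaarChar R γ : ℝ) * (nrm b : ℝ) := by
  rw [show (γ • b : R) = (γ : R) * b from rfl, hmul, NNReal.coe_mul]

omit [BorelSpace R] [μ.IsAddHaarMeasure] [μ.Regular] in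
include hnm hmul in
/-- **The modulus annulus `{A/‖γ‖ < nrm ≤ A}` is a fundamental domain for `γ^ℤ`** acting on `(R, ν)`, `ν = nrm⁻¹ · μ`, whenever `‖γ‖_R > 1` and `nrm > 0` `μ`-a.e. (★ B1).
[cite: WeilBNT1967, Ch. II §5 Prop. 12] -/
theorem isFundamentalDomain_modulusShell {γ : Rˣ} (hγ : 1 < distribHaarChar R γ) (hpos : ∀ᵐ b ∂μ, 0 < nrm b) {A : ℝ} (hA : 0 < A) :
    IsFundamentalDomain (↥(Subgroup.zpowers γ)) ((fun b : R => (nrm b : ℝ)) ⁻¹' Set.Ioc (A / (distribHaarChar R γ : ℝ)) A)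
      (μ.withDensity fun b => ((nrm b)⁻¹ : ℝ≥0)) := by
  refine isFundamentalDomain_heightShell _ (by exact_mod_cast hγ) (coe_nrm_units_smul hmul γ) ?_ hA ?_
  · exact withDensity_absolutelyContinuous μ _ (hpos.mono fun b hb => by exact_mod_cast hb)
  · exact (NNReal.continuous_coe.measurable.comp hnm measurableSet_Ioc).nullMeasurableSet

include hnm hmul in
/-- The action of `zpowers γ` on `(R, ν)` is measurable and measure preserving (★ B1 §5 + §1). [cite: WeilBNT1967, Ch. VII §2] -/
theorem smulInvariantMeasure_zpowers_units (γ : Rˣ) :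
    SMulInvariantMeasure (↥(Subgroup.zpowers γ)) R (μ.withDensity fun b => ((nrm b)⁻¹ : ℝ≥0)) :=
  smulInvariantMeasure_zpowers _ (measurePreserving_units_smul_withDensity_inv μ hnm hmul γ) (measurable_const_smul (γ⁻¹ : Rˣ))

include hnm hmul in
/-- **«MODULUS-SHELL CHARACTER VANISHING», `ν`-form.**  `‖γ‖_R > 1`, `nrm > 0` a.e., `h` invariant under `γ` and `h (b₀ b) = c • h b` with `c ≠ 1`: `∫_{A/‖γ‖ < nrm ≤ A} h dν = 0`,
`ν = nrm⁻¹ · μ`. [cite: TateThesis1967, §2.4] [cite: Keys1984, §7 Thm. (1)] -/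
theorem setIntegral_modulusShell_withDensity_eq_zero_of_eigen_unit {𝕜 : Type*} [RCLike 𝕜] {E : Type*} [NormedAddCommGroup E] [NormedSpace ℝ E] [NormedSpace 𝕜 E]
    {γ : Rˣ} (hγ : 1 < distribHaarChar R γ) (hpos : ∀ᵐ b ∂μ, 0 < nrm b) {A : ℝ} (hA : 0 < A)
    (h : R → E) (hh : ∀ b, h (γ • b) = h b) {b₀ : Rˣ} {c : 𝕜} (hc : c ≠ 1) (hb₀ : ∀ b, h (b₀ • b) = c • h b) :
    ∫ b in (fun b : R => (nrm b : ℝ)) ⁻¹' Set.Ioc (A / (distribHaarChar R γ : ℝ)) A, h b ∂(μ.withDensity fun b => ((nrm b)⁻¹ : ℝ≥0)) = 0 := by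
  haveI := measurableConstSMul_zpowers (α := R) (measurable_const_smul γ) (measurable_const_smul (γ⁻¹ : Rˣ))
  haveI := smulInvariantMeasure_zpowers_units μ hnm hmul γ
  exact setIntegral_heightShell_eq_zero_of_eigen_smul _ (by exact_mod_cast hγ) (coe_nrm_units_smul hmul γ)
    (withDensity_absolutelyContinuous μ _ (hpos.mono fun b hb => by exact_mod_cast hb)) hA
    ((NNReal.continuous_coe.measurable.comp hnm measurableSet_Ioc).nullMeasurableSet)
    h hh (Commute.all (b₀ : Rˣ) γ) (measurePreserving_units_smul_withDensity_inv μ hnm hmul b₀) (measurable_const_smul (b₀⁻¹ : Rˣ)) hc hb₀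

include hnm hmul in
/-- **«MODULUS-SHELL CHARACTER VANISHING★».**  `R` a locally compact commutative ring with a regular Haar measure `μ`, `nrm : R → ℝ≥0` measurable, `Rˣ`-equivariant (`nrm (u b) = ‖u‖_R nrm b`)
and positive a.e.; `γ ∈ Rˣ` with `‖γ‖_R > 1`; `h : R → E` with `h (γ b) = h b` and `h (b₀ b) = c • h b` for some unit `b₀` and scalar `c ≠ 1`.  Then for every `A > 0`
**`∫_{b : A/‖γ‖ < nrm b ≤ A} (nrm b)⁻¹ • h b dμ = 0`** — the integral of `h` against `db∕‖b‖` over ANY modulus annulus of ratio `‖γ‖` vanishes.  For a local field `E_w`, `γ = ϖ^{-r}` and a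
multiplicative character `h = χ ≠ 1` with `χ(γ) = 1` this is «`∑_{k=j}^{j+r-1} ∫_{ϖ^k𝒪^×} χ d×x = 0`» in all ramification cases at once. [cite: TateThesis1967, §2.4] [cite: WeilBNT1967, Ch. VII §2]
[cite: Keys1984, §7 Thm. (1)] -/
theorem setIntegral_modulusShell_eq_zero_of_eigen_unit {𝕜 : Type*} [RCLike 𝕜] {E : Type*} [NormedAddCommGroup E] [NormedSpace ℝ E] [NormedSpace 𝕜 E]
    {γ : Rˣ} (hγ : 1 < distribHaarChar R γ) (hpos : ∀ᵐ b ∂μ, 0 < nrm b) {A : ℝ} (hA : 0 < A)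
    (h : R → E) (hh : ∀ b, h (γ • b) = h b) {b₀ : Rˣ} {c : 𝕜} (hc : c ≠ 1) (hb₀ : ∀ b, h (b₀ • b) = c • h b) :
    ∫ b in (fun b : R => (nrm b : ℝ)) ⁻¹' Set.Ioc (A / (distribHaarChar R γ : ℝ)) A, ((nrm b)⁻¹ : ℝ≥0) • h b ∂μ = 0 := by
  have hS : MeasurableSet ((fun b : R => (nrm b : ℝ)) ⁻¹' Set.Ioc (A / (distribHaarChar R γ : ℝ)) A) :=
    NNReal.continuous_coe.measurable.comp hnm measurableSet_Ioc
  have key := setIntegral_withDensity_eq_setIntegral_smul (μ := μ) (f := fun b : R => (nrm b)⁻¹) hnm.inv h hS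
  beta_reduce at key
  rw [← key]
  exact setIntegral_modulusShell_withDensity_eq_zero_of_eigen_unit μ hnm hmul hγ hpos hA h hh hc hb₀

end Summit.HodgeConjecture.HodgeConjecture.Cruxes.H413.F0P3cStCharTSModulusShellCharacterVanishing

end
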